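import Mathlib.GroupTheory.PushoutI
import Mathlib.GroupTheory.FreeGroup.NielsenSchreier
import HarnessLib

/-!
# The action groupoid of an amalgam acting with free factor actions, I: orbit frames and sections

Topic `Literature/GroupTheory/CombinatorialGroupTheory`; first of two files (`AmalgamFreeSubgroups.lean`
concludes).  Goal of the pair: for an amalgamated free product `Γ = ∗_H G i` (Mathlib's
`Monoid.PushoutI φ`, `φ i : H →* G i`) and a subgroup `K ≤ Γ` meeting no conjugate of a factor `of i (G i)`
or of the base `base φ H`, `K` is a FREE group — the group-theoretic content of "a group acting on a tree
with trivial vertex stabilisers is free" for the Bass–Serre tree of an amalgam: D. E. Cohen,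
*Combinatorial Group Theory: a topological approach*, LMS Student Texts 14 (1989), Ch. 8, Cor. to Thm. 54
and the last sentence of Prop. 56 ("The kernel of the homomorphism from `π(𝔊)` to `Sym X` will be
free"), p. 240 of the cell's held copy [cite: CohenCGT1989, Ch. 8 Prop. 56 p.240]; J.-P. Serre, *Trees*,
I §4–5.

## Route (no Bass–Serre tree is built)

We follow Mathlib's proof of the Nielsen–Schreier theorem (`Mathlib.GroupTheory.FreeGroup.NielsenSchreier`,
D. Wärn): a vertex group of a connected FREE GROUPOID is free
(`IsFreeGroupoid.endIsFreeOfConnectedFree`), and `K` is the vertex group of the action groupoid of `Γ`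
on `Γ ⧸ K` (`CategoryTheory.ActionCategory.endMulEquivSubgroup`).  The new input (next file,
`OrbitFrame.isFreeGroupoid`): if `Γ = PushoutI φ` acts on a set `A` so that every factor `G i` (through
`of i`) and the base `H` (through `base φ`) act FREELY, then `ActionCategory Γ A` is a free groupoid.

THIS FILE: the generating quiver and the EXISTENCE half.  Choose representatives of the `H`-orbits
(`rH`) and, among the `H`-representatives, representatives of the `G i`-orbits (`r i`) — an
`OrbitFrame`; the generators are the "star" arrows `rH b ⟶ b` (labelled by the element of `H` doing
this) and, for each `i`, the arrows `r i b ⟶ b` for `H`-representatives `b` (labelled by the element of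
`G i`).  A labelling of these arrows in a group `X` extends to a functor
`ActionCategory Γ A ⥤ SingleObj X` (`functorOfLabelling`): functors correspond to sections
`Γ →* (A → X) ⋊ Γ` (`ActionCategory.curry`/`uncurry`), which by the universal property of the pushout
correspond to compatible sections over the `G i` and `H`; since each factor acts freely, its sections are
the COBOUNDARIES of "potential" functions `A → X` normalised on the orbit representatives, and the
potentials are read off the labels.  (This is the statement that the quotient graph of groups of a free
action has trivial vertex groups, so its fundamental groupoid is free [Serre, *Trees*, I §3, §5].)
Written for the abc-iut cell's F-2732 brick programme (brick «finite amalgams are virtually free»,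
`FiniteAmalgamVirtuallyFree.lean`); pure group theory, no new named facts, takes no side on anything.
-/
namespace Literature.GroupTheory.CombinatorialGroupTheory

open CategoryTheory CategoryTheory.ActionCategory SemidirectProduct Monoid

universe u

namespace AmalgamFreeSubgroups

variable {ι : Type u} {G : ι → Type u} [∀ i, Group (G i)] {H : Type u} [Group H]
  (φ : ∀ i, H →* G i) (A : Type u) [MulAction (PushoutI φ) A]

/-- **Orbit frame** of an action of `Γ = PushoutI φ` on `A`: representatives `rH` of the `H`-orbits with
elements `η a ∈ H` carrying `rH a` to `a`, and, for each factor, representatives `r i` of the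
`G i`-orbits chosen AMONG the `H`-representatives, with elements `κ i a ∈ G i` carrying `r i a` to `a`.
(Pure choice data; exists for every action, `OrbitFrame.nonempty`.) [cite: CohenCGT1989, Ch. 8 Prop. 56 p.240] -/
structure OrbitFrame where
  /-- representative of the `H`-orbit -/
  rH : A → A
  /-- an element of `H` moving `rH a` to `a` -/
  η : A → H
  base_η_smul : ∀ a, PushoutI.base φ (η a) • rH a = a
  rH_base_smul : ∀ (h : H) (a : A), rH (PushoutI.base φ h • a) = rH a
  /-- representative of the `G i`-orbit, itself an `H`-representative -/
  r : ι → A → A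
  /-- an element of `G i` moving `r i a` to `a` -/
  κ : ∀ i, A → G i
  of_κ_smul : ∀ i a, PushoutI.of (φ := φ) i (κ i a) • r i a = a
  r_of_smul : ∀ i (g : G i) (a : A), r i (PushoutI.of (φ := φ) i g • a) = r i a
  rH_r : ∀ i a, rH (r i a) = r i a

variable {φ A}

/-- Orbit frames exist (axiom of choice). [cite: CohenCGT1989, Ch. 8 Prop. 56 p.240] -/
theorem OrbitFrame.nonempty : Nonempty (OrbitFrame φ A) := by
  classical
  -- `H`-orbits
  let SH : Setoid A :=
    { r := fun a b => ∃ h : H, PushoutI.base φ h • a = b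
      iseqv :=
        { refl := fun a => ⟨1, by rw [map_one, one_smul]⟩
          symm := fun {a b} ⟨h, hh⟩ => ⟨h⁻¹, by rw [← hh, map_inv, inv_smul_smul]⟩
          trans := fun {a b c} ⟨h, hh⟩ ⟨k, hk⟩ => ⟨k * h, by rw [map_mul, mul_smul, hh, hk]⟩ } }
  let rH : A → A := fun a => (Quotient.mk SH a).out
  have hrel : ∀ a, ∃ h : H, PushoutI.base φ h • rH a = a := fun a => Quotient.mk_out (s := SH) a
  choose η hη using hrel
  have hrH : ∀ (h : H) (a : A), rH (PushoutI.base φ h • a) = rH a := by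
    intro h a
    have : Quotient.mk SH (PushoutI.base φ h • a) = Quotient.mk SH a :=
      Quotient.sound ⟨h⁻¹, by rw [map_inv, inv_smul_smul]⟩
    simp only [rH, this]
  have hrHrH : ∀ a, rH (rH a) = rH a := fun a => by
    conv_rhs => rw [← hη a]
    rw [hrH]
  -- `G i`-orbits
  let S : ∀ i : ι, Setoid A := fun i =>
    { r := fun a b => ∃ g : G i, PushoutI.of (φ := φ) i g • a = b
      iseqv :=
        { refl := fun a => ⟨1, by rw [map_one, one_smul]⟩
          symm := fun {a b} ⟨g, hg⟩ => ⟨g⁻¹, by rw [← hg, map_inv, inv_smul_smul]⟩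
          trans := fun {a b c} ⟨g, hg⟩ ⟨k, hk⟩ => ⟨k * g, by rw [map_mul, mul_smul, hg, hk]⟩ } }
  let r : ι → A → A := fun i a => rH (Quotient.mk (S i) a).out
  have hout : ∀ i a, ∃ g : G i, PushoutI.of (φ := φ) i g • (Quotient.mk (S i) a).out = a :=
    fun i a => Quotient.mk_out (s := S i) a
  choose g₀ hg₀ using hout
  have hκ : ∀ i a, PushoutI.of (φ := φ) i (g₀ i a * φ i (η (Quotient.mk (S i) a).out)) • r i a = a := by
    intro i a
    have h1 := hη (Quotient.mk (S i) a).out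
    simp only [r, map_mul, mul_smul, PushoutI.of_apply_eq_base]
    rw [h1]
    exact hg₀ i a
  have hr : ∀ i (g : G i) (a : A), r i (PushoutI.of (φ := φ) i g • a) = r i a := by
    intro i g a
    have : Quotient.mk (S i) (PushoutI.of (φ := φ) i g • a) = Quotient.mk (S i) a :=
      Quotient.sound ⟨g⁻¹, by rw [map_inv, inv_smul_smul]⟩
    simp only [r, this]
  exact ⟨⟨rH, η, hη, hrH, r, fun i a => g₀ i a * φ i (η (Quotient.mk (S i) a).out), hκ, hr,
    fun i a => hrHrH _⟩⟩

namespace OrbitFrame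

variable (D : OrbitFrame φ A)

/-- The object of the action groupoid over `a : A` (Mathlib's coercion `↑a`, with an explicit type).
[cite: CohenCGT1989, Ch. 8 Prop. 56 p.240] -/
abbrev ob (_D : OrbitFrame φ A) (a : A) : ActionCategory (PushoutI φ) A := ⟨PUnit.unit, a⟩

/-- The morphism `ob z ⟶ ob a` of the action groupoid given by an element `m` with `m • z = a`. [cite: CohenCGT1989, Ch. 8 Prop. 56 p.240] -/
abbrev homOf (z a : A) (m : PushoutI φ) (hm : m • z = a) : D.ob z ⟶ D.ob a := Subtype.mk m hm

/-- `rH` is idempotent. [cite: CohenCGT1989, Ch. 8 Prop. 56 p.240] -/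
theorem rH_rH (a : A) : D.rH (D.rH a) = D.rH a := by
  conv_rhs => rw [← D.base_η_smul a]
  rw [D.rH_base_smul]

/-- `r i` is idempotent. [cite: CohenCGT1989, Ch. 8 Prop. 56 p.240] -/
theorem r_r (i : ι) (a : A) : D.r i (D.r i a) = D.r i a := by
  conv_rhs => rw [← D.of_κ_smul i a]
  rw [D.r_of_smul]

/-- `r i` is constant on `H`-orbits, in particular `r i (rH a) = r i a`. [cite: CohenCGT1989, Ch. 8 Prop. 56 p.240] -/
theorem r_rH (i : ι) (a : A) : D.r i (D.rH a) = D.r i a := by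
  conv_rhs => rw [← D.base_η_smul a]
  rw [← PushoutI.of_apply_eq_base φ i, D.r_of_smul]

section Free

-- freeness of the base action: only `1 ∈ H` has fixed points
variable (hbase : ∀ (h : H) (a : A), PushoutI.base φ h • a = a → h = 1)
-- freeness of the factor actions: only `1 ∈ G i` has fixed points
variable (hfree : ∀ (i : ι) (g : G i) (a : A), PushoutI.of (φ := φ) i g • a = a → g = 1)

include hbase in
/-- Under freeness of `H`: `base h • z = base h' • z → h = h'`. [cite: CohenCGT1989, Ch. 8 Prop. 56 p.240] -/
theorem base_smul_injective {h h' : H} {z : A}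
    (e : PushoutI.base φ h • z = PushoutI.base φ h' • z) : h = h' := by
  have : PushoutI.base φ (h'⁻¹ * h) • z = z := by
    rw [map_mul, mul_smul, e, map_inv, inv_smul_smul]
  have h1 := hbase _ _ this
  rwa [inv_mul_eq_one, eq_comm] at h1

include hfree in
/-- Under freeness of `G i`: `of i g • z = of i g' • z → g = g'`. [cite: CohenCGT1989, Ch. 8 Prop. 56 p.240] -/
theorem of_smul_injective {i : ι} {g g' : G i} {z : A}
    (e : PushoutI.of (φ := φ) i g • z = PushoutI.of (φ := φ) i g' • z) : g = g' := by
  have : PushoutI.of (φ := φ) i (g'⁻¹ * g) • z = z := by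
    rw [map_mul, mul_smul, e, map_inv, inv_smul_smul]
  have h1 := hfree _ _ _ this
  rwa [inv_mul_eq_one, eq_comm] at h1

include hbase in
/-- At an `H`-representative, `η` is trivial. [cite: CohenCGT1989, Ch. 8 Prop. 56 p.240] -/
theorem η_eq_one_of_rH_eq {a : A} (ha : D.rH a = a) : D.η a = 1 := by
  have h := D.base_η_smul a
  rw [ha] at h
  exact hbase _ _ h

include hfree in
/-- At a `G i`-representative, `κ i` is trivial. [cite: CohenCGT1989, Ch. 8 Prop. 56 p.240] -/
theorem κ_eq_one_of_r_eq {i : ι} {a : A} (ha : D.r i a = a) : D.κ i a = 1 := by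
  have h := D.of_κ_smul i a
  rw [ha] at h
  exact hfree _ _ _ h

end Free

/-! ### The generating quiver and its labels -/

/-- The generating arrows `x ⟶ y` of the action groupoid: an `H`-star arrow (when `x = rH y ≠ y`) or,
for some factor `i`, a `G i`-star arrow into an `H`-representative `y` (when `x = r i y ≠ y = rH y`).
[cite: CohenCGT1989, Ch. 8 Prop. 56 p.240] -/
def Edge (x y : ActionCategory (PushoutI φ) A) : Type u :=
  {_u : PUnit.{u + 1} // D.rH y.back = x.back ∧ D.rH y.back ≠ y.back} ⊕
    {i : ι // D.r i y.back = x.back ∧ D.rH y.back = y.back ∧ D.r i y.back ≠ y.back}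

/-- The morphism of the action groupoid named by a generating arrow: `base (η y)`, resp. `of i (κ i y)`.
[cite: CohenCGT1989, Ch. 8 Prop. 56 p.240] -/
def edgeHom {x y : ActionCategory (PushoutI φ) A} : D.Edge x y → (x ⟶ y)
  | .inl e => Subtype.mk (PushoutI.base φ (D.η y.back))
      (show PushoutI.base φ (D.η y.back) • x.back = y.back by
        have h := D.base_η_smul y.back
        rw [e.2.1] at h
        exact h)
  | .inr e => Subtype.mk (PushoutI.of (φ := φ) e.1 (D.κ e.1 y.back))
      (show PushoutI.of (φ := φ) e.1 (D.κ e.1 y.back) • x.back = y.back by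
        have h := D.of_κ_smul e.1 y.back
        rw [e.2.1] at h
        exact h)

/-- Bookkeeping step of the free-action-groupoid argument (`edgeHom_inl_val`). [cite: CohenCGT1989, Ch. 8 Prop. 56 p.240] -/
@[simp] theorem edgeHom_inl_val {x y : ActionCategory (PushoutI φ) A}
    (e : {_u : PUnit.{u + 1} // D.rH y.back = x.back ∧ D.rH y.back ≠ y.back}) :
    (D.edgeHom (.inl e)).val = PushoutI.base φ (D.η y.back) := rfl

/-- Bookkeeping step of the free-action-groupoid argument (`edgeHom_inr_val`). [cite: CohenCGT1989, Ch. 8 Prop. 56 p.240] -/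
@[simp] theorem edgeHom_inr_val {x y : ActionCategory (PushoutI φ) A}
    (e : {i : ι // D.r i y.back = x.back ∧ D.rH y.back = y.back ∧ D.r i y.back ≠ y.back}) :
    (D.edgeHom (.inr e)).val = PushoutI.of (φ := φ) e.1 (D.κ e.1 y.back) := rfl

variable {X : Type u} [Group X] (f : ∀ ⦃x y : ActionCategory (PushoutI φ) A⦄, D.Edge x y → X)

/-- The `H`-potential of a labelling: the label of the star arrow `rH a ⟶ a` (`1` at representatives).
[cite: CohenCGT1989, Ch. 8 Prop. 56 p.240] -/
noncomputable def LH (a : A) : X := by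
  classical
  exact if h : D.rH a ≠ a then f (x := D.ob (D.rH a)) (y := D.ob a) (.inl ⟨PUnit.unit, rfl, h⟩) else 1

/-- The `G i`-potential of a labelling at an `H`-representative: the label of `r i a ⟶ a` (`1` when this
is not a generating arrow). [cite: CohenCGT1989, Ch. 8 Prop. 56 p.240] -/
noncomputable def Li (i : ι) (a : A) : X := by
  classical
  exact if h : D.rH a = a ∧ D.r i a ≠ a then
    f (x := D.ob (D.r i a)) (y := D.ob a) (.inr ⟨i, rfl, h.1, h.2⟩) else 1

/-- The total potential for the factor `i`: the label of the tree path `r i a ⟶ rH a ⟶ a`. [cite: CohenCGT1989, Ch. 8 Prop. 56 p.240] -/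
noncomputable def P (i : ι) (a : A) : X := D.LH f a * D.Li f i (D.rH a)

/-- Bookkeeping step of the free-action-groupoid argument (`LH_of_rH_eq`). [cite: CohenCGT1989, Ch. 8 Prop. 56 p.240] -/
theorem LH_of_rH_eq {a : A} (h : D.rH a = a) : D.LH f a = 1 := by
  classical
  unfold LH; rw [dif_neg (not_not.mpr h)]

/-- Bookkeeping step of the free-action-groupoid argument (`LH_of_rH_ne`). [cite: CohenCGT1989, Ch. 8 Prop. 56 p.240] -/
theorem LH_of_rH_ne {a : A} (h : D.rH a ≠ a) :
    D.LH f a = f (x := D.ob (D.rH a)) (y := D.ob a) (.inl ⟨PUnit.unit, rfl, h⟩) := by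
  classical
  unfold LH; rw [dif_pos h]

/-- Bookkeeping step of the free-action-groupoid argument (`Li_of_r_eq`). [cite: CohenCGT1989, Ch. 8 Prop. 56 p.240] -/
theorem Li_of_r_eq {i : ι} {a : A} (h : D.r i a = a) : D.Li f i a = 1 := by
  classical
  unfold Li; rw [dif_neg (fun hh => hh.2 h)]

/-- Bookkeeping step of the free-action-groupoid argument (`Li_of_pos`). [cite: CohenCGT1989, Ch. 8 Prop. 56 p.240] -/
theorem Li_of_pos {i : ι} {a : A} (ha : D.rH a = a) (h : D.r i a ≠ a) :
    D.Li f i a = f (x := D.ob (D.r i a)) (y := D.ob a) (.inr ⟨i, rfl, ha, h⟩) := by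
  classical
  unfold Li; rw [dif_pos ⟨ha, h⟩]

/-- Bookkeeping step of the free-action-groupoid argument (`P_r`). [cite: CohenCGT1989, Ch. 8 Prop. 56 p.240] -/
theorem P_r (i : ι) (a : A) : D.P f i (D.r i a) = 1 := by
  unfold P
  rw [D.LH_of_rH_eq f (D.rH_r i a), D.rH_r, D.Li_of_r_eq f (D.r_r i a), mul_one]

/-- Bookkeeping step of the free-action-groupoid argument (`P_of_rH_eq`). [cite: CohenCGT1989, Ch. 8 Prop. 56 p.240] -/
theorem P_of_rH_eq {i : ι} {a : A} (h : D.rH a = a) : D.P f i a = D.Li f i a := by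
  unfold P; rw [D.LH_of_rH_eq f h, h, one_mul]

/-! ### Sections of the semidirect product `(A → X) ⋊ Γ` -/

section Semidirect

variable {Γ : Type u} [Group Γ] {B : Type u} [MulAction Γ B] {Y : Type u} [Group Y]

/-- The coboundary section attached to a potential `Q : B → Y`, `γ ↦ inl Q · inr γ · (inl Q)⁻¹`, lies over
`γ`. [cite: CohenCGT1989, Ch. 8 Prop. 56 p.240] -/
theorem conj_inl_inr_right (Q : B → Y) (γ : Γ) :
    ((inl Q : (B → Y) ⋊[mulAutArrow] Γ) * inr γ * (inl Q)⁻¹).right = γ := by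
  simp [mul_right, inv_right]

/-- Its function part is `b ↦ Q b · Q (γ⁻¹ • b)⁻¹`. [cite: CohenCGT1989, Ch. 8 Prop. 56 p.240] -/
theorem conj_inl_inr_left (Q : B → Y) (γ : Γ) (b : B) :
    ((inl Q : (B → Y) ⋊[mulAutArrow] Γ) * inr γ * (inl Q)⁻¹).left b = Q b * (Q (γ⁻¹ • b))⁻¹ := by
  rw [mul_left, mul_left, inv_left, mul_right, left_inl, right_inl, left_inr, right_inr, map_one,
    mul_one, one_mul, inv_one, map_one, MulAut.one_apply]
  rfl

end Semidirect

/-- The section over `H` determined by a labelling. [cite: CohenCGT1989, Ch. 8 Prop. 56 p.240] -/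
noncomputable def σH : H →* (A → X) ⋊[mulAutArrow] PushoutI φ :=
  ((MulAut.conj (inl (D.LH f))).toMonoidHom.comp inr).comp (PushoutI.base φ)

/-- The section over the factor `G i` determined by a labelling. [cite: CohenCGT1989, Ch. 8 Prop. 56 p.240] -/
noncomputable def σi (i : ι) : G i →* (A → X) ⋊[mulAutArrow] PushoutI φ :=
  ((MulAut.conj (inl (D.P f i))).toMonoidHom.comp inr).comp (PushoutI.of (φ := φ) i)

/-- Bookkeeping step of the free-action-groupoid argument (`σH_apply`). [cite: CohenCGT1989, Ch. 8 Prop. 56 p.240] -/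
theorem σH_apply (h : H) :
    D.σH f h = inl (D.LH f) * inr (PushoutI.base φ h) * (inl (D.LH f))⁻¹ := rfl

/-- Bookkeeping step of the free-action-groupoid argument (`σi_apply`). [cite: CohenCGT1989, Ch. 8 Prop. 56 p.240] -/
theorem σi_apply (i : ι) (g : G i) :
    D.σi f i g = inl (D.P f i) * inr (PushoutI.of (φ := φ) i g) * (inl (D.P f i))⁻¹ := rfl

/-- Bookkeeping step of the free-action-groupoid argument (`σH_right`). [cite: CohenCGT1989, Ch. 8 Prop. 56 p.240] -/
theorem σH_right (h : H) : (D.σH f h).right = PushoutI.base φ h := by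
  rw [σH_apply, conj_inl_inr_right]

/-- Bookkeeping step of the free-action-groupoid argument (`σi_right`). [cite: CohenCGT1989, Ch. 8 Prop. 56 p.240] -/
theorem σi_right (i : ι) (g : G i) : (D.σi f i g).right = PushoutI.of (φ := φ) i g := by
  rw [σi_apply, conj_inl_inr_right]

/-- Bookkeeping step of the free-action-groupoid argument (`σH_left`). [cite: CohenCGT1989, Ch. 8 Prop. 56 p.240] -/
theorem σH_left (h : H) (b : A) :
    (D.σH f h).left b = D.LH f b * (D.LH f ((PushoutI.base φ h)⁻¹ • b))⁻¹ := by
  rw [σH_apply, conj_inl_inr_left]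

/-- Bookkeeping step of the free-action-groupoid argument (`σi_left`). [cite: CohenCGT1989, Ch. 8 Prop. 56 p.240] -/
theorem σi_left (i : ι) (g : G i) (b : A) :
    (D.σi f i g).left b = D.P f i b * (D.P f i ((PushoutI.of (φ := φ) i g)⁻¹ • b))⁻¹ := by
  rw [σi_apply, conj_inl_inr_left]

/-- The sections agree on `H`: the potentials differ by a function constant on `H`-orbits. [cite: CohenCGT1989, Ch. 8 Prop. 56 p.240] -/
theorem σi_comp_φ (i : ι) : (D.σi f i).comp (φ i) = D.σH f := by
  ext h b
  · rw [MonoidHom.comp_apply, σi_left, σH_left, PushoutI.of_apply_eq_base]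
    unfold P
    rw [← map_inv, D.rH_base_smul, mul_inv_rev, ← mul_assoc, mul_inv_cancel_right]
  · rw [MonoidHom.comp_apply, σi_right, σH_right, PushoutI.of_apply_eq_base]

/-- The section `Γ →* (A → X) ⋊ Γ` determined by a labelling (universal property of the pushout).
[cite: CohenCGT1989, Ch. 8 Prop. 56 p.240] -/
noncomputable def σ : PushoutI φ →* (A → X) ⋊[mulAutArrow] PushoutI φ :=
  PushoutI.lift (D.σi f) (D.σH f) (D.σi_comp_φ f)

/-- Bookkeeping step of the free-action-groupoid argument (`rightHom_comp_σ`). [cite: CohenCGT1989, Ch. 8 Prop. 56 p.240] -/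
theorem rightHom_comp_σ : rightHom.comp (D.σ f) = MonoidHom.id _ := by
  refine PushoutI.hom_ext (fun i => ?_) ?_
  · ext g
    simp only [σ, MonoidHom.comp_apply, PushoutI.lift_of, rightHom_eq_right, σi_right,
      MonoidHom.id_apply]
  · ext h
    simp only [σ, MonoidHom.comp_apply, PushoutI.lift_base, rightHom_eq_right, σH_right,
      MonoidHom.id_apply]

/-- Bookkeeping step of the free-action-groupoid argument (`σ_right`). [cite: CohenCGT1989, Ch. 8 Prop. 56 p.240] -/
theorem σ_right (γ : PushoutI φ) : (D.σ f γ).right = γ := by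
  have := DFunLike.congr_fun (D.rightHom_comp_σ f) γ
  simpa using this

/-- The functor `ActionCategory Γ A ⥤ SingleObj X` extending a labelling. [cite: CohenCGT1989, Ch. 8 Prop. 56 p.240] -/
noncomputable def functorOfLabelling : ActionCategory (PushoutI φ) A ⥤ SingleObj X :=
  uncurry (D.σ f) (D.σ_right f)

/-- Bookkeeping step of the free-action-groupoid argument (`functorOfLabelling_map`). [cite: CohenCGT1989, Ch. 8 Prop. 56 p.240] -/
theorem functorOfLabelling_map {x y : ActionCategory (PushoutI φ) A} (m : x ⟶ y) :
    (D.functorOfLabelling f).map m = (D.σ f m.val).left y.back := rfl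

/-- The extension takes the prescribed value on `H`-star arrows. [cite: CohenCGT1989, Ch. 8 Prop. 56 p.240] -/
theorem functorOfLabelling_map_inl (a b : A)
    (e : {_u : PUnit.{u + 1} // D.rH (D.ob b).back = (D.ob a).back ∧ D.rH (D.ob b).back ≠ (D.ob b).back}) :
    (D.functorOfLabelling f).map (D.edgeHom (x := D.ob a) (y := D.ob b) (.inl e)) =
      f (x := D.ob a) (y := D.ob b) (.inl e) := by
  obtain ⟨⟨⟩, hab, hne⟩ := e
  change D.rH b = a at hab
  change D.rH b ≠ b at hne
  subst hab
  rw [functorOfLabelling_map, edgeHom_inl_val]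
  change (D.σ f (PushoutI.base φ (D.η b))).left b = _
  rw [σ, PushoutI.lift_base, σH_left]
  have hb : (PushoutI.base φ (D.η b))⁻¹ • b = D.rH b := by
    rw [inv_smul_eq_iff, D.base_η_smul]
  rw [hb, D.LH_of_rH_eq f (D.rH_rH b), inv_one, mul_one, D.LH_of_rH_ne f hne]

/-- The extension takes the prescribed value on `G i`-star arrows. [cite: CohenCGT1989, Ch. 8 Prop. 56 p.240] -/
theorem functorOfLabelling_map_inr (a b : A)
    (e : {i : ι // D.r i (D.ob b).back = (D.ob a).back ∧ D.rH (D.ob b).back = (D.ob b).back ∧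
      D.r i (D.ob b).back ≠ (D.ob b).back}) :
    (D.functorOfLabelling f).map (D.edgeHom (x := D.ob a) (y := D.ob b) (.inr e)) =
      f (x := D.ob a) (y := D.ob b) (.inr e) := by
  obtain ⟨i, hab, hb, hne⟩ := e
  change D.r i b = a at hab
  change D.rH b = b at hb
  change D.r i b ≠ b at hne
  subst hab
  rw [functorOfLabelling_map, edgeHom_inr_val]
  change (D.σ f (PushoutI.of (φ := φ) i (D.κ i b))).left b = _
  rw [σ, PushoutI.lift_of, σi_left]
  have hb' : (PushoutI.of (φ := φ) i (D.κ i b))⁻¹ • b = D.r i b := by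
    rw [inv_smul_eq_iff, D.of_κ_smul]
  rw [hb', D.P_r, inv_one, mul_one, D.P_of_rH_eq f hb, D.Li_of_pos f hb hne]

end OrbitFrame

end AmalgamFreeSubgroups

end Literature.GroupTheory.CombinatorialGroupTheory
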